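import Mathlib.CategoryTheory.Monoidal.Cartesian.Grp
import HarnessLib

/-!
# The shear isomorphisms of a group object in a cartesian monoidal category

`Φ = (pr₁, m) : (x, y) ↦ (x, x·y)` and `Ψ = (m, pr₂) : (x, y) ↦ (x·y, y)` on `E ⊗ E` for a group object `E`
(e.g. a group scheme over a field, `Over (Spec K)` with Mathlib's cartesian monoidal structure) are ISOMORPHISMS,
with inverses `(x, z) ↦ (x, x⁻¹ z)` and `(z, y) ↦ (z y⁻¹, y)`.  Pure category theory over Mathlib's `GrpObj` /
`CartesianMonoidalCategory` / `Hom.group`; theorems only.  Cell `hodgecm-mathlib`, road W (r₀) leaf (W0) L5, first rung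
(B-p18 `W0-SPEC.md` §1 (P4) / §3 L5: «Φ_K, Ψ_K are the shear isomorphisms of the K-group scheme E»).
HC_CM is proved only modulo the 7 printed citations until rung 0 closes; banked leaf, no floor change.

## References
* [BLRNeronModels1990] S. Bosch, W. Lütkebohmert, M. Raynaud, *Néron Models*, Springer (1990), §4.3 / §5.1 Def. 1 (the maps
  `Φ`, `Ψ` of a birational group law; on a genuine group they are isomorphisms).
-/

universe v u

open CategoryTheory MonoidalCategory CartesianMonoidalCategory MonObj

namespace Literature.AlgebraicGeometry.GroupSchemes

variable {C : Type u} [Category.{v} C] [CartesianMonoidalCategory C] (E : C) [GrpObj E]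

/-- `Φ ∘ Φ⁻¹ = 1`: `(x, z) ↦ (x, x⁻¹ z) ↦ (x, x (x⁻¹ z)) = (x, z)`. [folklore] -/
private theorem lift_fst_inv_mul_snd_comp_lift_fst_mul :
    lift (fst E E) ((fst E E)⁻¹ * snd E E) ≫ lift (fst E E) μ[E] = 𝟙 (E ⊗ E) := by
  rw [MonObj.mul_eq_mul, comp_lift, lift_fst, MonObj.comp_mul, lift_fst, lift_snd, mul_inv_cancel_left,
    lift_fst_snd]

/-- `Φ⁻¹ ∘ Φ = 1`: `(x, y) ↦ (x, x y) ↦ (x, x⁻¹ (x y)) = (x, y)`. [folklore] -/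
private theorem lift_fst_mul_comp_lift_fst_inv_mul_snd :
    lift (fst E E) μ[E] ≫ lift (fst E E) ((fst E E)⁻¹ * snd E E) = 𝟙 (E ⊗ E) := by
  rw [MonObj.mul_eq_mul, comp_lift, lift_fst, MonObj.comp_mul, GrpObj.comp_inv, lift_fst, lift_snd,
    inv_mul_cancel_left, lift_fst_snd]

/-- **The left shear `Φ = (pr₁, m) : E ⊗ E ⟶ E ⊗ E`, `(x, y) ↦ (x, x·y)`, of a group object is an isomorphism.**
[cite: BLRNeronModels1990, §5.1 Def. 1 and §4.3] -/
theorem isIso_lift_fst_mul : IsIso (lift (fst E E) μ[E]) :=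
  ⟨lift (fst E E) ((fst E E)⁻¹ * snd E E), lift_fst_mul_comp_lift_fst_inv_mul_snd E,
    lift_fst_inv_mul_snd_comp_lift_fst_mul E⟩

/-- `Ψ ∘ Ψ⁻¹ = 1`: `(z, y) ↦ (z y⁻¹, y) ↦ ((z y⁻¹) y, y) = (z, y)`. [folklore] -/
private theorem lift_fst_mul_inv_snd_snd_comp_lift_mul_snd :
    lift (fst E E * (snd E E)⁻¹) (snd E E) ≫ lift μ[E] (snd E E) = 𝟙 (E ⊗ E) := by
  rw [MonObj.mul_eq_mul, comp_lift, lift_snd, MonObj.comp_mul, lift_fst, lift_snd, inv_mul_cancel_right,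
    lift_fst_snd]

/-- `Ψ⁻¹ ∘ Ψ = 1`: `(x, y) ↦ (x y, y) ↦ ((x y) y⁻¹, y) = (x, y)`. [folklore] -/
private theorem lift_mul_snd_comp_lift_fst_mul_inv_snd_snd :
    lift μ[E] (snd E E) ≫ lift (fst E E * (snd E E)⁻¹) (snd E E) = 𝟙 (E ⊗ E) := by
  rw [MonObj.mul_eq_mul, comp_lift, lift_snd, MonObj.comp_mul, GrpObj.comp_inv, lift_fst, lift_snd,
    mul_inv_cancel_right, lift_fst_snd]

/-- **The right shear `Ψ = (m, pr₂) : E ⊗ E ⟶ E ⊗ E`, `(x, y) ↦ (x·y, y)`, of a group object is an isomorphism.**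
[cite: BLRNeronModels1990, §5.1 Def. 1 and §4.3] -/
theorem isIso_lift_mul_snd : IsIso (lift μ[E] (snd E E)) :=
  ⟨lift (fst E E * (snd E E)⁻¹) (snd E E), lift_mul_snd_comp_lift_fst_mul_inv_snd_snd E,
    lift_fst_mul_inv_snd_snd_comp_lift_mul_snd E⟩

end Literature.AlgebraicGeometry.GroupSchemes
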